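import Summits.QuantumFields.YangMills.Theorems.PoincareLipschitzQuaternionCurrentsHSystem
import Summits.QuantumFields.YangMills.Theorems.PoincareLipschitzPlanarStreamFunctionBundleL2
import Summits.QuantumFields.YangMills.Theorems.PoincareLipschitzConeLinkTransport
import HarnessLib

/-!
# Crux `BlockLipschitzL` (stmt-QuantumFields-23533) ∕ `HistoryTailL` (stmt-QuantumFields-19936), LINE 25 «CompactnessTransfer»,
# the (TM) road — ROAD (W)'s SOCKET: «(GAP) ⟸ THE `3π` ENERGY GAP OF THE H-SYSTEM (F′)», NO NAMED FACT IN THE STATEMENT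

Cell `ym3-torus` (YM ladder rung R3 = continuum SU(2) Yang–Mills on T³ — a RUNG, NOT Clay: not d = 4, not infinite volume,
not a mass gap); WIDTH helper seat `ym3-torus-px19` g8 (ROAD (H) architect; this file is the consumer-side socket for ★w3 g16's
ROAD (W) memo `ROAD-W-WENTE-3PI-w3g16.md` db1aa60a §0); `--supports stmt-QuantumFields-23533`; THEOREMS ONLY (0 `def`, 0 `sorry`,
default heartbeats); imports this seat's ✓(Q)×2, px5 g9's ✓H8 `…PlanarStreamFunctionBundleL2.doorH_sq` (stream functions WITH the
`L²_loc` row (i′)), px14 g7 ∕ px16 g10's ✓(T) door `…ConeLinkTransport.exists_link_of_linear_energies`.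

WHAT THIS FILE PROVES.  ★★★ `gap_of_hSystemGap (hF′) : ⟨(GAP)⟩` — px3 g9's frozen (GAP) binder (30a3f4556be5a68a) from the ROAD (W)
target (F′) taken as a HYPOTHESIS in its final row form: «for `B : ℝ² → ℝ³` Sobolev on `ℝ²` (i) with `‖B‖² ∈ L¹_loc` (i′), finite
Dirichlet energy (ii), solving the H-system rows (iii) [= the (F) binder 83add449 rows verbatim], `∫|∇B|² ≤ 3π ⟹ ∫|∇B|² = 0`».
So the day ROAD (W) lands `hSystem_energy_zero_of_le_three_pi` (sharp two-point Wente + the equality case), (GAP) — hence S1″ and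
`BlockLipschitzL` — hold with NO named fact on the continuum side: `gap_of_hSystemGap hSystem_energy_zero_of_le_three_pi`.
Same proof as ✓`gap_of_hSystemQuantization_of_doors` with (H) := `doorH_sq` and the last step replaced by (F′) at `Θ ≤ 3π`.
HONEST SCOPE.  Conditional on (F′) (hypothesis; ROAD (W)'s rows W-ONE∕W-TWO∕W-INV∕W-EN in flight by w7 g15, ★w3 g16, px22 g8, w4 g16);
(GAP)∕(TM), S1″, K1, `MeanDeviationL`, `BlockLipschitzL`, `HistoryTailL` NOT proved here.  YM₃ on T³ is rung R3, not Clay; YM gap NOT proved.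

References: H. Brezis, J.-M. Coron (1985) [BrezisCoron1985] (the H-system); H. C. Wente (1969); P. Topping, Comment. Math. Helv. 72
(1997) (the sharp constant `1∕2π`); R. Schoen, K. Uhlenbeck (1984) [SchoenUhlenbeck1984] (Prop. 1.2, re-derived).
-/

set_option autoImplicit false

noncomputable section

open MeasureTheory Set Function Filter Topology Metric TopologicalSpace
open scoped ContDiff ENNReal BigOperators RealInnerProductSpace

namespace Summit.QuantumFields.YangMills.Theorems.PoincareLipschitzGapOfHSystemGap

open Literature.Analysis.FunctionSpaces
open Summit.QuantumFields.YangMills.Theorems.PoincareLipschitzQuaternionCurrents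
open Summit.QuantumFields.YangMills.Theorems.PoincareLipschitzQuaternionCurrentsHSystem

/-- ★★★ **(GAP) FROM THE `3π` GAP OF THE H-SYSTEM — THE DOOR FOR ROAD (W)** (transport (T) as a hypothesis, stream functions by
px5's ✓`doorH_sq`). [cite: SchoenUhlenbeck1984, Proposition 1.2; BrezisCoron1985, Appendix, Lemma A.1] -/
theorem gap_of_hSystemGap_of_transport
    (hF' : ∀ (B : EuclideanSpace ℝ (Fin 2) → EuclideanSpace ℝ (Fin 3))
      (GB : EuclideanSpace ℝ (Fin 2) → (EuclideanSpace ℝ (Fin 2) →L[ℝ] EuclideanSpace ℝ (Fin 3))),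
      HasWeakFDerivOn ⟨Set.univ, isOpen_univ⟩ volume B GB →
      LocallyIntegrable (fun y => ‖B y‖ ^ 2) volume →
      Integrable (fun y => ∑ k : Fin 2, ‖GB y (EuclideanSpace.single k (1:ℝ))‖ ^ 2) →
      (∀ (η : EuclideanSpace ℝ (Fin 2) → ℝ), ContDiff ℝ ∞ η → HasCompactSupport η → ∀ a : Fin 3,
        -(∫ y, ∑ k : Fin 2, fderiv ℝ η y (EuclideanSpace.single k (1:ℝ)) * (GB y (EuclideanSpace.single k (1:ℝ))) a) =
          2 * ∫ y, η y * ((GB y (EuclideanSpace.single 0 (1:ℝ))) (a + 1) * (GB y (EuclideanSpace.single 1 (1:ℝ))) (a + 2) -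
            (GB y (EuclideanSpace.single 0 (1:ℝ))) (a + 2) * (GB y (EuclideanSpace.single 1 (1:ℝ))) (a + 1))) →
      ∫ y, ∑ k : Fin 2, ‖GB y (EuclideanSpace.single k (1:ℝ))‖ ^ 2 ≤ 3 * Real.pi →
      ∫ y, ∑ k : Fin 2, ‖GB y (EuclideanSpace.single k (1:ℝ))‖ ^ 2 = 0)
    (hT : ∀ (hQ : IsOpen {x : EuclideanSpace ℝ (Fin 3) | ∀ i : Fin 3, |x i| < 1}) (U : EuclideanSpace ℝ (Fin 3) → EuclideanSpace ℝ (Fin 4)) (G : EuclideanSpace ℝ (Fin 3) → (EuclideanSpace ℝ (Fin 3) →L[ℝ] EuclideanSpace ℝ (Fin 4))),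
      (HasWeakFDerivOn ⟨{x : EuclideanSpace ℝ (Fin 3) | ∀ i : Fin 3, |x i| < 1}, hQ⟩ volume U G ∧
        (∀ x : EuclideanSpace ℝ (Fin 3), (∀ i : Fin 3, |x i| < 1) → ‖U x‖ = 1) ∧
        IntegrableOn (fun x => ∑ i : Fin 3, ‖G x (EuclideanSpace.single i (1:ℝ))‖ ^ 2) {x : EuclideanSpace ℝ (Fin 3) | ∀ i : Fin 3, |x i| < 1} ∧
        (∀ (y : EuclideanSpace ℝ (Fin 3)) (ρ : ℝ), 0 < ρ → closedBall y ρ ⊆ {x : EuclideanSpace ℝ (Fin 3) | ∀ i : Fin 3, |x i| < 1} →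
          ∀ (W : EuclideanSpace ℝ (Fin 3) → EuclideanSpace ℝ (Fin 4)) (GW : EuclideanSpace ℝ (Fin 3) → (EuclideanSpace ℝ (Fin 3) →L[ℝ] EuclideanSpace ℝ (Fin 4))),
          HasWeakFDerivOn ⟨{x : EuclideanSpace ℝ (Fin 3) | ∀ i : Fin 3, |x i| < 1}, hQ⟩ volume W GW →
          (∀ x : EuclideanSpace ℝ (Fin 3), (∀ i : Fin 3, |x i| < 1) → ‖W x‖ = 1) →
          IntegrableOn (fun x => ∑ i : Fin 3, ‖GW x (EuclideanSpace.single i (1:ℝ))‖ ^ 2) {x : EuclideanSpace ℝ (Fin 3) | ∀ i : Fin 3, |x i| < 1} →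
          (∃ ρ' : ℝ, ρ' < ρ ∧ ∀ x : EuclideanSpace ℝ (Fin 3), x ∉ ball y ρ' → W x = U x) →
          ∫ x in ball y ρ, ∑ i : Fin 3, ‖G x (EuclideanSpace.single i (1:ℝ))‖ ^ 2 ≤ ∫ x in ball y ρ, ∑ i : Fin 3, ‖GW x (EuclideanSpace.single i (1:ℝ))‖ ^ 2)) →
      ∀ Θ : ℝ, (∀ r : ℝ, 0 < r → r ≤ 1 / 2 → ∫ x in ball (0 : EuclideanSpace ℝ (Fin 3)) r, ∑ i : Fin 3, ‖G x (EuclideanSpace.single i (1:ℝ))‖ ^ 2 = Θ * r) →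
      ∃ (w : EuclideanSpace ℝ (Fin 2) → EuclideanSpace ℝ (Fin 4)) (Gw : EuclideanSpace ℝ (Fin 2) → (EuclideanSpace ℝ (Fin 2) →L[ℝ] EuclideanSpace ℝ (Fin 4))),
        HasWeakFDerivOn ⟨Set.univ, isOpen_univ⟩ volume w Gw ∧ (∀ y, ‖w y‖ = 1) ∧
        Integrable (fun y => ∑ k : Fin 2, ‖Gw y (EuclideanSpace.single k (1:ℝ))‖ ^ 2) volume ∧
        (∫ y, ∑ k : Fin 2, ‖Gw y (EuclideanSpace.single k (1:ℝ))‖ ^ 2 = Θ) ∧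
        (∀ (p q : EuclideanSpace ℝ (Fin 4)), ‖p‖ = 1 → ‖q‖ = 1 → ⟪p, q⟫ = 0 →
          ∀ η : EuclideanSpace ℝ (Fin 2) → ℝ, ContDiff ℝ ∞ η → HasCompactSupport η →
            ∫ y, ∑ k : Fin 2, fderiv ℝ η y (EuclideanSpace.single k (1:ℝ)) *
              (⟪p, w y⟫ * ⟪Gw y (EuclideanSpace.single k (1:ℝ)), q⟫ - ⟪q, w y⟫ * ⟪Gw y (EuclideanSpace.single k (1:ℝ)), p⟫) = 0)) :
    ∀ (hQ : IsOpen {x : EuclideanSpace ℝ (Fin 3) | ∀ i : Fin 3, |x i| < 1}) (U : EuclideanSpace ℝ (Fin 3) → EuclideanSpace ℝ (Fin 4)) (G : EuclideanSpace ℝ (Fin 3) → (EuclideanSpace ℝ (Fin 3) →L[ℝ] EuclideanSpace ℝ (Fin 4))),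
      (HasWeakFDerivOn ⟨{x : EuclideanSpace ℝ (Fin 3) | ∀ i : Fin 3, |x i| < 1}, hQ⟩ volume U G ∧
        (∀ x : EuclideanSpace ℝ (Fin 3), (∀ i : Fin 3, |x i| < 1) → ‖U x‖ = 1) ∧
        IntegrableOn (fun x => ∑ i : Fin 3, ‖G x (EuclideanSpace.single i (1:ℝ))‖ ^ 2) {x : EuclideanSpace ℝ (Fin 3) | ∀ i : Fin 3, |x i| < 1} ∧
        (∀ (y : EuclideanSpace ℝ (Fin 3)) (ρ : ℝ), 0 < ρ → closedBall y ρ ⊆ {x : EuclideanSpace ℝ (Fin 3) | ∀ i : Fin 3, |x i| < 1} →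
          ∀ (W : EuclideanSpace ℝ (Fin 3) → EuclideanSpace ℝ (Fin 4)) (GW : EuclideanSpace ℝ (Fin 3) → (EuclideanSpace ℝ (Fin 3) →L[ℝ] EuclideanSpace ℝ (Fin 4))),
          HasWeakFDerivOn ⟨{x : EuclideanSpace ℝ (Fin 3) | ∀ i : Fin 3, |x i| < 1}, hQ⟩ volume W GW →
          (∀ x : EuclideanSpace ℝ (Fin 3), (∀ i : Fin 3, |x i| < 1) → ‖W x‖ = 1) →
          IntegrableOn (fun x => ∑ i : Fin 3, ‖GW x (EuclideanSpace.single i (1:ℝ))‖ ^ 2) {x : EuclideanSpace ℝ (Fin 3) | ∀ i : Fin 3, |x i| < 1} →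
          (∃ ρ' : ℝ, ρ' < ρ ∧ ∀ x : EuclideanSpace ℝ (Fin 3), x ∉ ball y ρ' → W x = U x) →
          ∫ x in ball y ρ, ∑ i : Fin 3, ‖G x (EuclideanSpace.single i (1:ℝ))‖ ^ 2 ≤ ∫ x in ball y ρ, ∑ i : Fin 3, ‖GW x (EuclideanSpace.single i (1:ℝ))‖ ^ 2)) →
      ∀ Θ : ℝ, (∀ r : ℝ, 0 < r → r ≤ 1 / 2 → ∫ x in ball (0 : EuclideanSpace ℝ (Fin 3)) r, ∑ i : Fin 3, ‖G x (EuclideanSpace.single i (1:ℝ))‖ ^ 2 = Θ * r) →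
        Θ ≤ 3 * Real.pi → Θ = 0 := by
  intro hQ U G hcls Θ hlin hΘ
  -- (T): the link
  obtain ⟨w, Gw, hw, hw1, hE, hEΘ, hcl⟩ := hT hQ U G hcls Θ hlin
  -- the currents, hypothesis-pinned
  set J : Fin 4 → Fin 4 → EuclideanSpace ℝ (Fin 2) → Fin 2 → ℝ :=
    fun m n y k => w y m * Gw y (EuclideanSpace.single k (1:ℝ)) n - w y n * Gw y (EuclideanSpace.single k (1:ℝ)) m with hJdef
  have hJ : ∀ m n y k, J m n y k = w y m * Gw y (EuclideanSpace.single k (1:ℝ)) n - w y n * Gw y (EuclideanSpace.single k (1:ℝ)) m :=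
    fun _ _ _ _ => rfl
  set A : Fin 3 → EuclideanSpace ℝ (Fin 2) → Fin 2 → ℝ :=
    fun a y k => if a = 0 then J 0 1 y k - J 2 3 y k else if a = 1 then J 0 2 y k - J 3 1 y k else J 0 3 y k - J 1 2 y k with hAdef
  have hA : ∀ y k, A 0 y k = J 0 1 y k - J 2 3 y k ∧ A 1 y k = J 0 2 y k - J 3 1 y k ∧ A 2 y k = J 0 3 y k - J 1 2 y k :=
    fun y k => ⟨by simp [hAdef], by simp [hAdef], by simp [hAdef]⟩
  -- the `ℝ²`-valued bundle of the currents, for (H)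
  set A' : Fin 3 → EuclideanSpace ℝ (Fin 2) → EuclideanSpace ℝ (Fin 2) :=
    fun a y => A a y 0 • EuclideanSpace.single (0 : Fin 2) (1:ℝ) + A a y 1 • EuclideanSpace.single (1 : Fin 2) (1:ℝ) with hA'def
  have hA'0 : ∀ a y, A' a y 0 = A a y 0 := fun a y => by simp [hA'def]
  have hA'1 : ∀ a y, A' a y 1 = A a y 1 := fun a y => by simp [hA'def]
  have hA'k : ∀ a y (k : Fin 2), A' a y k = A a y k := fun a y k => by
    fin_cases k
    · exact hA'0 a y
    · exact hA'1 a y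
  -- measurability of the currents
  have hwm := aestronglyMeasurable_of_sobolev hw
  have hGm := aestronglyMeasurable_grad hw
  have hcoord : ∀ m : Fin 4, AEStronglyMeasurable (fun y => w y m) volume := fun m =>
    (EuclideanSpace.proj m : EuclideanSpace ℝ (Fin 4) →L[ℝ] ℝ).continuous.comp_aestronglyMeasurable hwm
  have hgcoord : ∀ (k : Fin 2) (m : Fin 4), AEStronglyMeasurable (fun y => Gw y (EuclideanSpace.single k (1:ℝ)) m) volume :=
    fun k m => (memLp_grad_coord hw hE k m).1
  have hJm : ∀ m n k, AEStronglyMeasurable (fun y => J m n y k) volume := fun m n k =>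
    ((hcoord m).mul (hgcoord k n)).sub ((hcoord n).mul (hgcoord k m))
  have hAm : ∀ a k, AEStronglyMeasurable (fun y => A a y k) volume := by
    intro a k
    fin_cases a
    · exact ((hJm 0 1 k).sub (hJm 2 3 k)).congr (Filter.Eventually.of_forall fun y => ((hA y k).1).symm)
    · exact ((hJm 0 2 k).sub (hJm 3 1 k)).congr (Filter.Eventually.of_forall fun y => ((hA y k).2.1).symm)
    · exact ((hJm 0 3 k).sub (hJm 1 2 k)).congr (Filter.Eventually.of_forall fun y => ((hA y k).2.2).symm)
  have hA'm : ∀ a, AEStronglyMeasurable (A' a) volume := fun a =>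
    ((hAm a 0).smul_const _).add ((hAm a 1).smul_const _)
  -- `‖A' a‖² ≤ |∇w|²` a.e., hence integrable
  have hen := leftCurrents_energy_ae hw hw1 hJ hA
  have hA'i : ∀ a, Integrable (fun y => ‖A' a y‖ ^ 2) volume := by
    intro a
    refine hE.mono' ((continuous_pow 2).comp_aestronglyMeasurable (hA'm a).norm) (hen.mono fun y hy => ?_)
    have hsq : ‖A' a y‖ ^ 2 = A a y 0 ^ 2 + A a y 1 ^ 2 := by
      rw [EuclideanSpace.norm_sq_eq]
      simp [hA'def, Fin.sum_univ_two]
    rw [Real.norm_eq_abs, abs_of_nonneg (sq_nonneg _), hsq, ← hy]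
    simp only [Fin.sum_univ_three, Fin.sum_univ_two]
    fin_cases a <;> simp <;> nlinarith [sq_nonneg (A 0 y 0), sq_nonneg (A 0 y 1), sq_nonneg (A 1 y 0), sq_nonneg (A 1 y 1),
      sq_nonneg (A 2 y 0), sq_nonneg (A 2 y 1)]
  -- (Q1): divergence-free
  have hdiv : ∀ a (η : EuclideanSpace ℝ (Fin 2) → ℝ), ContDiff ℝ ∞ η → HasCompactSupport η →
      ∫ y, ∑ k : Fin 2, fderiv ℝ η y (EuclideanSpace.single k (1:ℝ)) * A' a y k = 0 := by
    intro a η hη hηc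
    have h := leftCurrents_divFree hw hw1 hcl hJ hA a hη hηc
    simpa only [hA'k] using h
  -- (H): stream functions with the `L²_loc` row (px5 g9's H8 door)
  obtain ⟨B, GB, hB, hBL2, hGB', hEB⟩ :=
    Summit.QuantumFields.YangMills.Theorems.PoincareLipschitzPlanarStreamFunctionBundleL2.doorH_sq A' hA'm hA'i hdiv
  have hGB : ∀ y a, GB y (EuclideanSpace.single 0 (1:ℝ)) a = -A a y 1 ∧ GB y (EuclideanSpace.single 1 (1:ℝ)) a = A a y 0 := by
    intro y a
    obtain ⟨h0, h1⟩ := hGB' y a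
    exact ⟨by rw [h0, hA'1], by rw [h1, hA'0]⟩
  -- (Q4): the H-system rows and the energy
  have hrows := fun η hη hηc a => hSystem_rows hw hw1 hE hJ hA hGB η hη hηc a
  obtain ⟨-, hEBi, hEBeq⟩ := streamFunctions_energy hw hw1 hE hJ hA hGB
  -- (F′): the `3π` gap of the H-system
  have hΘB : ∫ y, ∑ k : Fin 2, ‖GB y (EuclideanSpace.single k (1:ℝ))‖ ^ 2 ≤ 3 * Real.pi := by
    rw [hEBeq, hEΘ]; exact hΘ
  have h0 := hF' B GB hB hBL2 hEBi hrows hΘB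
  rw [← hEΘ, ← hEBeq, h0]


/-- ★★★ **(GAP) FROM THE `3π` GAP OF THE H-SYSTEM ALONE** — the (T) door discharged by px14 g7's
✓`PoincareLipschitzConeLinkTransport.exists_link_of_linear_energies`: ROAD (W)'s socket. [cite: SchoenUhlenbeck1984, Proposition 1.2] -/
theorem gap_of_hSystemGap
    (hF' : ∀ (B : EuclideanSpace ℝ (Fin 2) → EuclideanSpace ℝ (Fin 3))
      (GB : EuclideanSpace ℝ (Fin 2) → (EuclideanSpace ℝ (Fin 2) →L[ℝ] EuclideanSpace ℝ (Fin 3))),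
      HasWeakFDerivOn ⟨Set.univ, isOpen_univ⟩ volume B GB →
      LocallyIntegrable (fun y => ‖B y‖ ^ 2) volume →
      Integrable (fun y => ∑ k : Fin 2, ‖GB y (EuclideanSpace.single k (1:ℝ))‖ ^ 2) →
      (∀ (η : EuclideanSpace ℝ (Fin 2) → ℝ), ContDiff ℝ ∞ η → HasCompactSupport η → ∀ a : Fin 3,
        -(∫ y, ∑ k : Fin 2, fderiv ℝ η y (EuclideanSpace.single k (1:ℝ)) * (GB y (EuclideanSpace.single k (1:ℝ))) a) =
          2 * ∫ y, η y * ((GB y (EuclideanSpace.single 0 (1:ℝ))) (a + 1) * (GB y (EuclideanSpace.single 1 (1:ℝ))) (a + 2) -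
            (GB y (EuclideanSpace.single 0 (1:ℝ))) (a + 2) * (GB y (EuclideanSpace.single 1 (1:ℝ))) (a + 1))) →
      ∫ y, ∑ k : Fin 2, ‖GB y (EuclideanSpace.single k (1:ℝ))‖ ^ 2 ≤ 3 * Real.pi →
      ∫ y, ∑ k : Fin 2, ‖GB y (EuclideanSpace.single k (1:ℝ))‖ ^ 2 = 0) :
    ∀ (hQ : IsOpen {x : EuclideanSpace ℝ (Fin 3) | ∀ i : Fin 3, |x i| < 1}) (U : EuclideanSpace ℝ (Fin 3) → EuclideanSpace ℝ (Fin 4)) (G : EuclideanSpace ℝ (Fin 3) → (EuclideanSpace ℝ (Fin 3) →L[ℝ] EuclideanSpace ℝ (Fin 4))),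
      (HasWeakFDerivOn ⟨{x : EuclideanSpace ℝ (Fin 3) | ∀ i : Fin 3, |x i| < 1}, hQ⟩ volume U G ∧
        (∀ x : EuclideanSpace ℝ (Fin 3), (∀ i : Fin 3, |x i| < 1) → ‖U x‖ = 1) ∧
        IntegrableOn (fun x => ∑ i : Fin 3, ‖G x (EuclideanSpace.single i (1:ℝ))‖ ^ 2) {x : EuclideanSpace ℝ (Fin 3) | ∀ i : Fin 3, |x i| < 1} ∧
        (∀ (y : EuclideanSpace ℝ (Fin 3)) (ρ : ℝ), 0 < ρ → closedBall y ρ ⊆ {x : EuclideanSpace ℝ (Fin 3) | ∀ i : Fin 3, |x i| < 1} →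
          ∀ (W : EuclideanSpace ℝ (Fin 3) → EuclideanSpace ℝ (Fin 4)) (GW : EuclideanSpace ℝ (Fin 3) → (EuclideanSpace ℝ (Fin 3) →L[ℝ] EuclideanSpace ℝ (Fin 4))),
          HasWeakFDerivOn ⟨{x : EuclideanSpace ℝ (Fin 3) | ∀ i : Fin 3, |x i| < 1}, hQ⟩ volume W GW →
          (∀ x : EuclideanSpace ℝ (Fin 3), (∀ i : Fin 3, |x i| < 1) → ‖W x‖ = 1) →
          IntegrableOn (fun x => ∑ i : Fin 3, ‖GW x (EuclideanSpace.single i (1:ℝ))‖ ^ 2) {x : EuclideanSpace ℝ (Fin 3) | ∀ i : Fin 3, |x i| < 1} →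
          (∃ ρ' : ℝ, ρ' < ρ ∧ ∀ x : EuclideanSpace ℝ (Fin 3), x ∉ ball y ρ' → W x = U x) →
          ∫ x in ball y ρ, ∑ i : Fin 3, ‖G x (EuclideanSpace.single i (1:ℝ))‖ ^ 2 ≤ ∫ x in ball y ρ, ∑ i : Fin 3, ‖GW x (EuclideanSpace.single i (1:ℝ))‖ ^ 2)) →
      ∀ Θ : ℝ, (∀ r : ℝ, 0 < r → r ≤ 1 / 2 → ∫ x in ball (0 : EuclideanSpace ℝ (Fin 3)) r, ∑ i : Fin 3, ‖G x (EuclideanSpace.single i (1:ℝ))‖ ^ 2 = Θ * r) →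
        Θ ≤ 3 * Real.pi → Θ = 0 :=
  gap_of_hSystemGap_of_transport hF'
    Summit.QuantumFields.YangMills.Theorems.PoincareLipschitzConeLinkTransport.exists_link_of_linear_energies

end Summit.QuantumFields.YangMills.Theorems.PoincareLipschitzGapOfHSystemGap
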